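import Summits.CriticalPhenomena.PercolationContinuityZ3.Theorems.PercNearOneGluingNoHeavyLowerTailSahiCTCLadderThreeRowFourPrep
import HarnessLib

/-!
# `NoHeavyLowerTail` (crux stmt-CriticalPhenomena-4575), P3 lane: preparations for the row `#dbl = 3` of the level-3 ladder `(L_3)`

Support file (seat `prim-l12-p3`, gen 26; `--supports stmt-CriticalPhenomena-4575`).  Paper proof: `prim-l12-p3/ROW3-PROOF-g26.md` (memo g26 §4.9).
For a profile `m ≤ 2` with doubled set `D = dbl m`, `#D = 3`, and single set `T = lev m 1` (`τ = #T`) the coefficient `[m](e_3·H)`,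
`H = Π·GF(𝒳∩𝒵) − GF(𝒳)GF(𝒵)`, contains the Kleitman surpluses of three kinds of cubes — the 3-live RESTRICTION `κ_R = κ(∅, D ∪ T)`
(`coeff_harris_cube_R`), the 2-live LINKS `κ₂(d,y) = κ({d}, (D∖d) ∪ (T∖y))` (`coeff_harris_cube_L2`) and the 1-live LINKS
`κ₁(d,Q) = κ(D∖d, {d} ∪ (T∖Q))`, `Q ⊆ T` a pair (`coeff_harris_cube_L1`) — and dominates their sum (`cubes_le_coeff_ee_mul_harris_rowThree`);
the charge `[m](Θ_2·e_{≥3}·GF(W))` of a family `W` of 3-sets is at most `cH(3,τ+3)·[D ∈ W] + (τ+2)·#{w : #(D∩w) = 2} + #{w : #(D∩w) = 1}`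
(`coeff_chargeT_rowThree_le`); the PEEL chain `kap_peel_le` (iterated vertex recursion along a list of points) and the exact base on ≤ 5 points
(`kap_empty_eq_card_common_of_card_le_five`, `card_le_kap_base`) used to bound `κ_R`.  These are the two sides of the accounting of ROW3-PROOF §2–3.
Nothing is asserted about the crux.
-/

namespace Summit.CriticalPhenomena.PercolationContinuityZ3.Theorems.SahiCTCForms

open Finset MvPolynomial SahiCTCGenFun SahiCTCWeightedLYM

variable {α : Type*} [DecidableEq α] [Fintype α]

section RowThree
variable {𝒳 𝒵 : Finset (Finset α)}

/-! #### The three kinds of cubes of the row `#dbl = 3` and their Harris coefficients -/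

/-- The 3-live restriction cube: `[m − 1_D] H = κ(𝒳,𝒵; ∅, D ∪ T)`. [this work] -/
theorem coeff_harris_cube_R {m : α →₀ ℕ} (hm : ∀ i, m i ≤ 2) :
    (PiP * gf (𝒳 ∩ 𝒵) - gf 𝒳 * gf 𝒵).coeff (m - ind (dbl m)) = kap 𝒳 𝒵 ∅ (dbl m ∪ lev m 1) := by
  rw [coeff_harrisForm_eq_kap _ _ (sub_ind_le_two_of_le_two hm _), dbl_sub_ind_of_le_two hm, sgl_sub_ind_of_le_two hm, sdiff_self,
    inter_self, sdiff_eq_self_of_disjoint (disjoint_dbl_lev_one m).symm]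
  rfl

/-- The 2-live link cube at `(d, y)`, `d ∈ D`, `y ∈ T`: `[m − 1_{(D∖d)+y}] H = κ(𝒳,𝒵; {d}, (D∖d) ∪ (T∖y))`. [this work] -/
theorem coeff_harris_cube_L2 {m : α →₀ ℕ} (hm : ∀ i, m i ≤ 2) {d : α} (hd : d ∈ dbl m) {y : α} (hy : y ∈ lev m 1) :
    (PiP * gf (𝒳 ∩ 𝒵) - gf 𝒳 * gf 𝒵).coeff (m - ind (insert y ((dbl m).erase d))) =
      kap 𝒳 𝒵 {d} ((dbl m).erase d ∪ (lev m 1).erase y) := by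
  rw [coeff_harrisForm_eq_kap _ _ (sub_ind_le_two_of_le_two hm _), dbl_sub_ind_of_le_two hm, sgl_sub_ind_of_le_two hm]
  have hyD : y ∉ dbl m := fun h => disjoint_left.1 (disjoint_dbl_lev_one m) h hy
  have hdT : d ∉ lev m 1 := fun h => disjoint_left.1 (disjoint_dbl_lev_one m) hd h
  congr 1
  · ext i; simp only [mem_sdiff, mem_insert, mem_erase, not_or, mem_singleton]
    constructor
    · rintro ⟨hi, hne, h⟩; by_contra hid; exact h ⟨hid, hi⟩
    · rintro rfl; exact ⟨hd, fun h => hyD (h ▸ hd), fun h => h.1 rfl⟩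
  · congr 1
    · ext i; simp only [mem_inter, mem_insert, mem_erase]
      constructor
      · rintro ⟨hi, rfl | ⟨hne, hi'⟩⟩
        · exact absurd hi hyD
        · exact ⟨hne, hi'⟩
      · rintro ⟨hne, hi⟩; exact ⟨hi, Or.inr ⟨hne, hi⟩⟩
    · ext i; simp only [mem_sdiff, mem_insert, mem_erase, not_or]
      constructor
      · rintro ⟨hi, hne, h⟩; exact ⟨hne, hi⟩
      · rintro ⟨hne, hi⟩; exact ⟨hi, hne, fun h => disjoint_left.1 (disjoint_dbl_lev_one m) h.2 hi⟩

/-- The 1-live link cube at `(d, Q)`, `d ∈ D`, `Q ⊆ T`: `[m − 1_{d+Q}] H = κ(𝒳,𝒵; D∖d, {d} ∪ (T∖Q))`. [this work] -/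
theorem coeff_harris_cube_L1 {m : α →₀ ℕ} (hm : ∀ i, m i ≤ 2) {d : α} (hd : d ∈ dbl m) {Q : Finset α} (hQ : Q ⊆ lev m 1) :
    (PiP * gf (𝒳 ∩ 𝒵) - gf 𝒳 * gf 𝒵).coeff (m - ind (insert d Q)) =
      kap 𝒳 𝒵 ((dbl m).erase d) (insert d (lev m 1 \ Q)) := by
  rw [coeff_harrisForm_eq_kap _ _ (sub_ind_le_two_of_le_two hm _), dbl_sub_ind_of_le_two hm, sgl_sub_ind_of_le_two hm]
  have hQD : Disjoint Q (dbl m) := (disjoint_dbl_lev_one m).symm.mono_left hQ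
  have hdT : d ∉ lev m 1 := fun h => disjoint_left.1 (disjoint_dbl_lev_one m) hd h
  congr 1
  · ext i; simp only [mem_sdiff, mem_insert, mem_erase, not_or]
    constructor
    · rintro ⟨hi, hne, _⟩; exact ⟨hne, hi⟩
    · rintro ⟨hne, hi⟩; exact ⟨hi, hne, fun h => disjoint_left.1 hQD h hi⟩
  · ext i; simp only [mem_union, mem_inter, mem_insert, mem_sdiff]
    constructor
    · rintro (⟨hi, rfl | hiQ⟩ | ⟨hi, h⟩)
      · exact Or.inl rfl
      · exact absurd hi (disjoint_left.1 hQD hiQ)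
      · exact Or.inr ⟨hi, fun hq => h (Or.inr hq)⟩
    · rintro (rfl | ⟨hi, hiQ⟩)
      · exact Or.inl ⟨hd, Or.inl rfl⟩
      · exact Or.inr ⟨hi, fun h => h.elim (fun h => hdT (h ▸ hi)) hiQ⟩

/-! #### The cube data of the row -/

/-- `κ_R`: the surplus of the 3-live restriction to `D ∪ T`. [this work] -/
def kapR (𝒳 𝒵 : Finset (Finset α)) (m : α →₀ ℕ) : ℤ := kap 𝒳 𝒵 ∅ (dbl m ∪ lev m 1)

/-- `κ₂(d,y)`: the surplus of the 2-live link at `d` restricted to `(D∖d) ∪ (T∖y)`. [this work] -/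
def kapL2 (𝒳 𝒵 : Finset (Finset α)) (m : α →₀ ℕ) (d y : α) : ℤ := kap 𝒳 𝒵 {d} ((dbl m).erase d ∪ (lev m 1).erase y)

/-- `κ₁(d,Q)`: the surplus of the 1-live link at the pair `D∖d` restricted to `{d} ∪ (T∖Q)`. [this work] -/
def kapL1 (𝒳 𝒵 : Finset (Finset α)) (m : α →₀ ℕ) (d : α) (Q : Finset α) : ℤ := kap 𝒳 𝒵 ((dbl m).erase d) (insert d (lev m 1 \ Q))

/-- **The surplus side contains the cubes of the row `#dbl = 3`**:
`κ_R + Σ_{d,y} κ₂(d,y) + Σ_{d} Σ_{Q ⊆ T, #Q = 2} κ₁(d,Q) ≤ [m](e_3·H)`. [this work] -/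
theorem cubes_le_coeff_ee_mul_harris_rowThree (h𝒳 : IsUpperSet (𝒳 : Set (Finset α))) (h𝒵 : IsUpperSet (𝒵 : Set (Finset α)))
    {m : α →₀ ℕ} (hm : ∀ i, m i ≤ 2) (hD : #(dbl m) = 3) :
    kapR 𝒳 𝒵 m + ∑ d ∈ dbl m, ∑ y ∈ lev m 1, kapL2 𝒳 𝒵 m d y +
        ∑ d ∈ dbl m, ∑ Q ∈ (lev m 1).powersetCard 2, kapL1 𝒳 𝒵 m d Q ≤
      (ee 3 * (PiP * gf (𝒳 ∩ 𝒵) - gf 𝒳 * gf 𝒵)).coeff m := by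
  unfold kapR kapL2 kapL1
  have hDT : Disjoint (dbl m) (lev m 1) := disjoint_dbl_lev_one m
  set S₀ : Finset (Finset α) := {dbl m} with hS₀
  set S₂ := (dbl m ×ˢ lev m 1).image fun q => insert q.2 ((dbl m).erase q.1) with hS₂
  set S₁ := (dbl m ×ˢ (lev m 1).powersetCard 2).image fun q => insert q.1 q.2 with hS₁
  -- admissibility
  have hadm : S₀ ∪ S₂ ∪ S₁ ⊆ (bySize (· = 3) : Finset (Finset α)).filter fun E => ind E ≤ m := by
    intro E hE
    rw [mem_filter, bySize, mem_filter, SahiAllButC.ind_le_iff_subset_support, support_eq_dbl_union_lev hm]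
    refine ⟨⟨mem_powerset.2 (subset_univ _), ?_⟩, ?_⟩
    · rcases mem_union.1 hE with hE | hE
      · rcases mem_union.1 hE with hE | hE
        · rw [mem_singleton.1 hE, hD]
        · obtain ⟨q, hq, rfl⟩ := mem_image.1 hE
          obtain ⟨hq1, hq2⟩ := mem_product.1 hq
          rw [card_insert_of_notMem (fun h => disjoint_left.1 hDT (mem_of_mem_erase h) hq2), card_erase_of_mem hq1, hD]
      · obtain ⟨q, hq, rfl⟩ := mem_image.1 hE
        obtain ⟨hq1, hq2⟩ := mem_product.1 hq
        obtain ⟨hQT, hQ2⟩ := mem_powersetCard.1 hq2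
        rw [card_insert_of_notMem (fun h => disjoint_left.1 hDT hq1 (hQT h)), hQ2]
    · rcases mem_union.1 hE with hE | hE
      · rcases mem_union.1 hE with hE | hE
        · rw [mem_singleton.1 hE]; exact subset_union_left
        · obtain ⟨q, hq, rfl⟩ := mem_image.1 hE
          obtain ⟨hq1, hq2⟩ := mem_product.1 hq
          exact insert_subset (mem_union_right _ hq2) ((erase_subset _ _).trans subset_union_left)
      · obtain ⟨q, hq, rfl⟩ := mem_image.1 hE
        obtain ⟨hq1, hq2⟩ := mem_product.1 hq
        exact insert_subset (mem_union_left _ hq1) ((mem_powersetCard.1 hq2).1.trans subset_union_right)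
  -- the three index sets are pairwise disjoint (count the points of D in a cube: 3, 2, 1)
  have hcardD : ∀ E, (E ∈ S₀ → #(dbl m ∩ E) = 3) ∧ (E ∈ S₂ → #(dbl m ∩ E) = 2) ∧ (E ∈ S₁ → #(dbl m ∩ E) = 1) := fun E => by
    refine ⟨fun h => by rw [mem_singleton.1 h, inter_self, hD], fun h => ?_, fun h => ?_⟩
    · obtain ⟨q, hq, rfl⟩ := mem_image.1 h
      obtain ⟨hq1, hq2⟩ := mem_product.1 hq
      rw [inter_insert_of_notMem (fun h => disjoint_left.1 hDT h hq2), inter_eq_right.2 (erase_subset _ _), card_erase_of_mem hq1, hD]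
    · obtain ⟨q, hq, rfl⟩ := mem_image.1 h
      obtain ⟨hq1, hq2⟩ := mem_product.1 hq
      rw [inter_insert_of_mem hq1, disjoint_iff_inter_eq_empty.1 (hDT.mono_right (mem_powersetCard.1 hq2).1),
        insert_empty_eq, card_singleton]
  have hd02 : Disjoint S₀ S₂ := disjoint_left.2 fun E h0 h2 => by
    have := (hcardD E).1 h0; have := (hcardD E).2.1 h2; omega
  have hd01 : Disjoint (S₀ ∪ S₂) S₁ := disjoint_left.2 fun E h h1 => by
    have h1' := (hcardD E).2.2 h1
    rcases mem_union.1 h with h | h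
    · have := (hcardD E).1 h; omega
    · have := (hcardD E).2.1 h; omega
  -- injectivity of the parametrisations
  have hinj₂ : Set.InjOn (fun q : α × α => insert q.2 ((dbl m).erase q.1)) ↑(dbl m ×ˢ lev m 1) := by
    intro q hq q' hq' h
    obtain ⟨hq1, hq2⟩ := mem_product.1 (Finset.mem_coe.1 hq)
    obtain ⟨hq1', hq2'⟩ := mem_product.1 (Finset.mem_coe.1 hq')
    have h' : insert q.2 ((dbl m).erase q.1) = insert q'.2 ((dbl m).erase q'.1) := h
    have hT : ∀ {E : Finset α} {a b : α}, a ∈ dbl m → b ∈ lev m 1 → (lev m 1 ∩ insert b ((dbl m).erase a)) = {b} :=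
      fun {E a b} ha hb => by
        rw [inter_insert_of_mem hb, disjoint_iff_inter_eq_empty.1 (hDT.symm.mono_right (erase_subset _ _)), insert_empty_eq]
    have hy : q.2 = q'.2 := by
      have e : lev m 1 ∩ insert q.2 ((dbl m).erase q.1) = lev m 1 ∩ insert q'.2 ((dbl m).erase q'.1) := by rw [h']
      rw [hT (E := ∅) hq1 hq2, hT (E := ∅) hq1' hq2'] at e
      exact singleton_injective e
    have hD' : ∀ {a b : α}, a ∈ dbl m → b ∈ lev m 1 → (dbl m \ insert b ((dbl m).erase a)) = {a} := fun {a b} ha hb => by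
      ext i; simp only [mem_sdiff, mem_insert, mem_erase, not_or, mem_singleton]
      constructor
      · rintro ⟨hi, _, h⟩; by_contra hia; exact h ⟨hia, hi⟩
      · rintro rfl; exact ⟨ha, fun h => disjoint_left.1 hDT ha (h ▸ hb), fun h => h.1 rfl⟩
    have hx : q.1 = q'.1 := by
      have e : dbl m \ insert q.2 ((dbl m).erase q.1) = dbl m \ insert q'.2 ((dbl m).erase q'.1) := by rw [h']
      rw [hD' hq1 hq2, hD' hq1' hq2'] at e
      exact singleton_injective e
    exact Prod.ext hx hy
  have hinj₁ : Set.InjOn (fun q : α × Finset α => insert q.1 q.2) ↑(dbl m ×ˢ (lev m 1).powersetCard 2) := by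
    intro q hq q' hq' h
    obtain ⟨hq1, hq2⟩ := mem_product.1 (Finset.mem_coe.1 hq)
    obtain ⟨hq1', hq2'⟩ := mem_product.1 (Finset.mem_coe.1 hq')
    have hQ := (mem_powersetCard.1 hq2).1
    have hQ' := (mem_powersetCard.1 hq2').1
    have h' : insert q.1 q.2 = insert q'.1 q'.2 := h
    have hx : q.1 = q'.1 := by
      have e : dbl m ∩ insert q.1 q.2 = dbl m ∩ insert q'.1 q'.2 := by rw [h']
      rw [inter_insert_of_mem hq1, inter_insert_of_mem hq1', disjoint_iff_inter_eq_empty.1 (hDT.mono_right hQ),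
        disjoint_iff_inter_eq_empty.1 (hDT.mono_right hQ'), insert_empty_eq, insert_empty_eq] at e
      exact singleton_injective e
    have hQQ : q.2 = q'.2 := by
      have e : (insert q.1 q.2).erase q.1 = (insert q'.1 q'.2).erase q.1 := by rw [h']
      rwa [erase_insert (fun h => disjoint_left.1 hDT hq1 (hQ h)), hx,
        erase_insert (fun h => disjoint_left.1 hDT hq1' (hQ' h))] at e
    exact Prod.ext hx hQQ
  have hsur := sum_le_coeff_ee_mul_harris h𝒳 h𝒵 3 m hadm
  rw [sum_union hd01, sum_union hd02, sum_singleton, sum_image hinj₂, sum_image hinj₁, coeff_harris_cube_R hm,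
    sum_congr rfl fun q hq => coeff_harris_cube_L2 hm (mem_product.1 hq).1 (mem_product.1 hq).2,
    sum_congr rfl fun q hq => coeff_harris_cube_L1 hm (mem_product.1 hq).1 (mem_powersetCard.1 (mem_product.1 hq).2).1,
    sum_product, sum_product] at hsur
  exact hsur

/-! #### The charge of the row -/

/-- **Charge bound in the row `#dbl = 3`**: for a family `W` of 3-sets,
`[m](Θ_2·e_{≥3}·GF(W)) ≤ cH(3, τ+3)·[D ∈ W] + (τ+2)·#{w ∈ W : 1_w ≤ m, #(D∩w) = 2} + #{w ∈ W : 1_w ≤ m, #(D∩w) = 1}`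
(`D = dbl m`, `τ = #(lev m 1) ≥ 2`, `m ≤ 2`, `#D = 3`). [this work] -/
theorem coeff_chargeT_rowThree_le {m : α →₀ ℕ} (hm : ∀ i, m i ≤ 2) (hD : #(dbl m) = 3) (hτ : 2 ≤ #(lev m 1))
    (W : Finset (Finset α)) (hW : ∀ w ∈ W, #w = 3) :
    (gf (bySize (· ≤ 3 - 1) : Finset (Finset α)) * gf (bySize (3 ≤ ·) : Finset (Finset α)) * gf W).coeff m ≤
      (if dbl m ∈ W then (cH 3 (#(lev m 1) + 3) : ℤ) else 0) +
        ((#(lev m 1) : ℤ) + 2) * #((W.filter fun w => ind w ≤ m).filter fun w => #(dbl m ∩ w) = 2) +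
        #((W.filter fun w => ind w ≤ m).filter fun w => #(dbl m ∩ w) = 1) := by
  rw [coeff_chargeT_eq_sum]
  set Wm := W.filter fun w => ind w ≤ m
  have hval : ∀ w ∈ Wm, (gf (bySize (· ≤ 3 - 1) : Finset (Finset α)) * gf (bySize (3 ≤ ·) : Finset (Finset α))).coeff (m - ind w) ≤
      (if w = dbl m then (cH 3 (#(lev m 1) + 3) : ℤ) else 0) + (if #(dbl m ∩ w) = 2 then ((#(lev m 1) : ℤ) + 2) else 0) +
        (if #(dbl m ∩ w) = 1 then 1 else 0) := fun w hw => by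
    obtain ⟨hwW, hwm⟩ := mem_filter.1 hw
    have hwt := hW w hwW
    rw [coeff_thetaT_mul_atLeastT_eq_cH (by norm_num) (sub_ind_le_two_of_le_two hm w), dbl_sub_ind_of_le_two hm, sgl_sub_ind_of_le_two hm]
    have hsd : #(dbl m \ w) + #(dbl m ∩ w) = 3 := by rw [card_sdiff_add_card_inter, hD]
    have hdisj : Disjoint (dbl m ∩ w) (lev m 1 \ w) :=
      Disjoint.mono inter_subset_left sdiff_subset (disjoint_dbl_lev_one m)
    have hcu : #(dbl m ∩ w ∪ lev m 1 \ w) = #(dbl m ∩ w) + #(lev m 1 \ w) := card_union_of_disjoint hdisj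
    have hTw : #(lev m 1 \ w) + #(lev m 1 ∩ w) = #(lev m 1) := card_sdiff_add_card_inter _ _
    by_cases h3 : #(dbl m ∩ w) = 3
    · -- w = D
      have heq : w = dbl m := by
        have := eq_of_subset_of_card_le (inter_subset_right (s₁ := dbl m) (s₂ := w)) (by rw [hwt, h3])
        have h2 := eq_of_subset_of_card_le (inter_subset_left (s₁ := dbl m) (s₂ := w)) (by rw [hD, h3])
        rw [← h2, this]
      subst heq
      rw [if_pos rfl, if_neg (by omega), if_neg (by omega), inter_self, sdiff_self, bot_eq_empty, card_empty,
        sdiff_eq_self_of_disjoint (disjoint_dbl_lev_one m).symm, card_union_of_disjoint (disjoint_dbl_lev_one m), hD,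
        show 3 - 0 = 3 from rfl, show 3 + #(lev m 1) = #(lev m 1) + 3 from by ring]
      simp
    have hne : w ≠ dbl m := fun h => h3 (by rw [h, inter_self, hD])
    rw [if_neg hne]
    have hlt : #(dbl m ∩ w) < 3 := by
      have := card_le_card (inter_subset_left (s₁ := dbl m) (s₂ := w)); omega
    by_cases h2 : #(dbl m ∩ w) = 2
    · rw [if_pos h2, if_neg (by omega), show 3 - #(dbl m \ w) = 2 from by omega, hcu, h2]
      -- #(T \ w) = τ − 1 : w has exactly one point outside D, and it lies in T
      have hwT : #(lev m 1 ∩ w) = 1 := by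
        have hwsupp : w ⊆ dbl m ∪ lev m 1 := by
          rw [← support_eq_dbl_union_lev hm]; exact (SahiAllButC.ind_le_iff_subset_support _ _).1 hwm
        have : #(dbl m ∩ w) + #(lev m 1 ∩ w) = #w := by
          rw [← card_union_of_disjoint (Disjoint.mono inter_subset_left inter_subset_left (disjoint_dbl_lev_one m)),
            ← union_inter_distrib_right, inter_eq_right.2 hwsupp]
        omega
      have hT1 : #(lev m 1 \ w) = #(lev m 1) - 1 := by omega
      rw [hT1]
      unfold cH
      rw [show min 2 (2 + (#(lev m 1) - 1) + 1 - 2) = 2 from by omega]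
      simp [sum_range_succ]
      omega
    · rw [if_neg h2]
      by_cases h1 : #(dbl m ∩ w) = 1
      · rw [if_pos h1, show 3 - #(dbl m \ w) = 1 from by omega]
        unfold cH
        have : 1 ≤ #(dbl m ∩ w ∪ lev m 1 \ w) := by rw [hcu]; omega
        rw [show min 1 (#(dbl m ∩ w ∪ lev m 1 \ w) + 1 - 1) = 1 from by omega]
        simp
      · rw [if_neg h1, show 3 - #(dbl m \ w) = 0 from by omega]
        unfold cH; simp
  refine (sum_le_sum hval).trans ?_
  have e0 : ∑ w ∈ Wm, (if w = dbl m then (cH 3 (#(lev m 1) + 3) : ℤ) else 0) = if dbl m ∈ W then (cH 3 (#(lev m 1) + 3) : ℤ) else 0 := by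
    rw [sum_ite_eq']
    have : dbl m ∈ Wm ↔ dbl m ∈ W := by
      simp only [Wm, mem_filter, and_iff_left_iff_imp]
      exact fun _ => (SahiAllButC.ind_le_iff_subset_support _ _).2 (dbl_subset_support m)
    simp only [this]
  have e2 : ∑ w ∈ Wm, (if #(dbl m ∩ w) = 2 then ((#(lev m 1) : ℤ) + 2) else 0) =
      ((#(lev m 1) : ℤ) + 2) * #(Wm.filter fun w => #(dbl m ∩ w) = 2) := by
    rw [← sum_filter, sum_const, nsmul_eq_mul, mul_comm]
  have e1 : ∑ w ∈ Wm, (if #(dbl m ∩ w) = 1 then (1 : ℤ) else 0) = #(Wm.filter fun w => #(dbl m ∩ w) = 1) := by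
    rw [sum_boole]
  rw [sum_add_distrib, sum_add_distrib, e0, e2, e1]

/-! #### The PEEL chain for a restriction cube and the exact base -/

/-- Peel sum along a list of points: `Σ_j κ(D + y_j, s ∖ {y_1,…,y_j})`. [this work] -/
def peelSum (𝒳 𝒵 : Finset (Finset α)) (D : Finset α) : Finset α → List α → ℤ
  | _, [] => 0
  | s, y :: l => kap 𝒳 𝒵 (insert y D) (s.erase y) + peelSum 𝒳 𝒵 D (s.erase y) l

omit [Fintype α] in
/-- **PEEL chain**: peeling the points of a list one after the other (vertex recursion `kap_rec`, dropping its nonnegative cross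
term) gives `κ(D, s ∖ l) + Σ_j κ(D + y_j, s ∖ {y_1..y_j}) ≤ κ(D, s)`. [this work] -/
theorem kap_peel_le (h𝒳 : IsUpperSet (𝒳 : Set (Finset α))) (h𝒵 : IsUpperSet (𝒵 : Set (Finset α))) {D : Finset α} :
    ∀ (l : List α) (s : Finset α), l.Nodup → (∀ y ∈ l, y ∈ s) → Disjoint D s →
      kap 𝒳 𝒵 D (s \ l.toFinset) + peelSum 𝒳 𝒵 D s l ≤ kap 𝒳 𝒵 D s := by
  intro l
  induction l with
  | nil => intro s _ _ _; simp [peelSum]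
  | cons y l ih =>
    intro s hnd hls hDs
    have hy : y ∈ s := hls y List.mem_cons_self
    have hyD : y ∉ D := fun h => disjoint_left.1 hDs h hy
    have hyl : y ∉ l := (List.nodup_cons.1 hnd).1
    have hrec := kap_rec (𝒳 := 𝒳) (𝒵 := 𝒵) h𝒳 h𝒵 hy hyD
    have hih := ih (s.erase y) (List.nodup_cons.1 hnd).2 (fun y' hy' => mem_erase.2 ⟨fun h => hyl (h ▸ hy'), hls y' (List.mem_cons_of_mem _ hy')⟩)
      (hDs.mono_right (erase_subset y s))
    have hsd : s \ (y :: l).toFinset = s.erase y \ l.toFinset := by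
      rw [List.toFinset_cons, sdiff_insert, erase_sdiff_comm]
    rw [hsd]
    simp only [peelSum]
    have h0 : (0 : ℤ) ≤ #((tr 𝒳 (insert y D) (s.erase y) \ tr 𝒳 D (s.erase y)).filter fun R =>
        (s.erase y) \ R ∈ tr 𝒵 (insert y D) (s.erase y) ∧ (s.erase y) \ R ∉ tr 𝒵 D (s.erase y)) := Nat.cast_nonneg _
    linarith

omit [Fintype α] in
/-- **Exact base for 3-live pairs on at most five points**: `κ(∅, B) = #(common subsets of B)`. [this work] -/
theorem kap_empty_eq_card_common_of_card_le_five (hX3 : ∀ S ∈ 𝒳, 3 ≤ #S) (hZ3 : ∀ S ∈ 𝒵, 3 ≤ #S) {B : Finset α} (hB : #B ≤ 5) :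
    kap 𝒳 𝒵 ∅ B = #((B.powerset.filter fun U => U ∈ 𝒳 ∧ U ∈ 𝒵)) := by
  rw [kap_eq_card_inter_of_lt_two_mul (t := 3) (fun U hU => hX3 U (by simpa using (mem_tr.1 hU).2))
    (fun U hU => hZ3 U (by simpa using (mem_tr.1 hU).2)) (by omega)]
  congr 1
  refine congrArg _ (Finset.ext fun U => ?_)
  simp only [mem_inter, mem_tr, empty_union, mem_filter, mem_powerset]
  tauto

omit [Fintype α] in
/-- A lower bound for the base by an explicit list of distinct common sets: if `L ⊆ 2^B` consists of common sets then `#L ≤ κ(∅, B)`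
(`#B ≤ 5`). [this work] -/
theorem card_le_kap_base (hX3 : ∀ S ∈ 𝒳, 3 ≤ #S) (hZ3 : ∀ S ∈ 𝒵, 3 ≤ #S) {B : Finset α} (hB : #B ≤ 5)
    {L : Finset (Finset α)} (hL : ∀ U ∈ L, U ⊆ B ∧ U ∈ 𝒳 ∧ U ∈ 𝒵) : (#L : ℤ) ≤ kap 𝒳 𝒵 ∅ B := by
  rw [kap_empty_eq_card_common_of_card_le_five hX3 hZ3 hB]
  exact_mod_cast card_le_card fun U hU => mem_filter.2 ⟨mem_powerset.2 (hL U hU).1, (hL U hU).2⟩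

end RowThree

end Summit.CriticalPhenomena.PercolationContinuityZ3.Theorems.SahiCTCForms
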